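import Summits.Ventures.PercRepro.RankLevelSetExplicitLin2ArithA

/-!
# PercRepro — THE ARITHMETIC OF THEOREM P⁗″, PART B1: `(C1)` AND THE SMALL CLASS IN REGIME I′ AT
`p ≥ Tq q = q·2^{q+1}` (p9, S4)

`proofs/SUBCLAIM-S4-p9.md` §S4.2⁗′. The assembled inequality `(P_d)` at level `q ≥ 8`, corank `q + 1 ≤ d ≤ q + 2^q`,
`8·(C(n,q) + W_s·A + W_b·B) ≤ 7·2^{d−q}·C(p+q,q)` (`n = p + d`), with the weights in their closed-form row bounds
`W_s·μ_s ≤ 2^{μ_s}` (`μ_s = min (5·2^{q−4} − q) d`, local sparsity `f(q−1) ≤ 5·2^{q−4} − 1` + the cap) and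
`W_b·μ_b ≤ 2^{μ_b}` (`μ_b = min (5·2^{q−3} − q − 1) d`, `f(q) ≤ 5·2^{q−3} − 1` + the cap), the small class
`6A ≤ A6` (Lemma T, Lemma T4, the `T_k` tail) and the big class `B ≤ C((q+3)d + 2q − 2, q)` (Lemma `T_k` at every
`k ≥ 3`, Vandermonde), is split into NINE term bounds, one regime each (this file: `(C1)` and regime I′; `RankLevelSetExplicitLin2ArithB2`: regimes II / III, the big class and the assembly `poly_main2`):
* `(C1)` `64·C(n,q) ≤ (64 + 2^{d−q})·C` (Bernoulli, valid at every corank since `2q·2^q ≤ p + 1`);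
* regime I′ (`d ≤ 5·2^{q−4}`, the small-class weight at its cap): `(S3)` `24·2^q·d(d+1)·C(n,q−2) ≤ 7μ_s·C`,
  `(S4)` `32·2^q·d(d+1)(d+2)·C(n,q−3) ≤ 3μ_s·C`, `(S5)` `96·2^q·C(2d+2q−2,4)·C(2d+2q−6+n, q−4) ≤ 35μ_s·C`
  (budget `13`), and at `d = q + 1` the same three with budget `6`;
* regimes II / III (`d > 5·2^{q−4}`, the small-class weight saturated at `m_s = 5·2^{q−4} − q` and DECAYING as
  `2^{m_s − d}`): `(S3′)`, `(S4′)`, `(S5′)` with the right sides `m_s·2^{d−m_s}·C`, `m_s·2^{d−m_s}·C`, `3m_s·2^{d−m_s}·C`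
  (so `8·W_s·A ≤ (1/2)·2^{d−q}·C`);
* the big class at every corank: `(B)` `16·2^q·C((q+3)d + 2q − 2, q) ≤ μ_b·2^{d−μ_b}·C` (budget `1/2`).
Axioms: standard.
-/

namespace PercRepro

namespace ThmN

namespace Explicit

/-- **(C1)**: `64·C(p+d, q) ≤ (64 + 2^{d−q})·C(p+q, q)` for `q ≥ 8`, `q + 1 ≤ d ≤ q + 2^q`, `p ≥ Tq q`. -/
theorem c1_bound2 (q d p : ℕ) (hq : 8 ≤ q) (hd1 : q + 1 ≤ d) (hd2 : d ≤ q + 2 ^ q) (hp : Tq q ≤ p) :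
    64 * (p + d).choose q ≤ (64 + 2 ^ (d - q)) * (p + q).choose q := by
  obtain ⟨-, -, h2q, -⟩ := Tq_bounds q hq
  set m := d - q with hm
  have hmq : 2 * q * m ≤ p + 1 := by
    have : m ≤ 2 ^ q := by omega
    nlinarith
  have hR := choose_mul_pow_le_choose_mul_pow p q d (by omega)
  have hB := add_pow_mul_le_pow_mul (p + 1) m q hmq
  have hpos : 0 < (p + 1) ^ q := by positivity
  -- `C(p+d,q)·(p+1) ≤ C·(p+1+2qm)`
  have h1 : (p + d).choose q * (p + 1) ≤ (p + q).choose q * (p + 1 + 2 * q * m) := by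
    apply Nat.le_of_mul_le_mul_right _ hpos
    calc (p + d).choose q * (p + 1) * (p + 1) ^ q = (p + d).choose q * (p + 1) ^ q * (p + 1) := by ring
      _ ≤ (p + q).choose q * (p + 1 + m) ^ q * (p + 1) := Nat.mul_le_mul_right _ hR
      _ = (p + q).choose q * ((p + 1 + m) ^ q * (p + 1)) := by ring
      _ ≤ (p + q).choose q * ((p + 1) ^ q * (p + 1 + 2 * q * m)) := Nat.mul_le_mul_left _ hB
      _ = (p + q).choose q * (p + 1 + 2 * q * m) * (p + 1) ^ q := by ring
  -- `128·q·m ≤ 2^m·(p+1)`: `64 m ≤ 2^{m+q}` as `2^q ≥ 256` and `m ≤ 2^m`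
  have h2 : 128 * q * m ≤ 2 ^ m * (p + 1) := by
    have hm2 : m ≤ 2 ^ m := (succ_le_two_pow m).trans' (by omega)
    have h64 : 64 ≤ 2 ^ q := by
      calc 64 ≤ 2 ^ 8 := by norm_num
        _ ≤ 2 ^ q := Nat.pow_le_pow_right (by norm_num) hq
    have : 2 * q * 2 ^ q ≤ p + 1 := by omega
    calc 128 * q * m ≤ 128 * q * 2 ^ m := Nat.mul_le_mul_left _ hm2
      _ = 2 ^ m * (64 * (2 * q)) := by ring
      _ ≤ 2 ^ m * (2 ^ q * (2 * q)) := Nat.mul_le_mul_left _ (Nat.mul_le_mul_right _ h64)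
      _ = 2 ^ m * (2 * q * 2 ^ q) := by ring
      _ ≤ 2 ^ m * (p + 1) := Nat.mul_le_mul_left _ this
  have hp1 : 0 < p + 1 := by omega
  apply Nat.le_of_mul_le_mul_right _ hp1
  calc 64 * (p + d).choose q * (p + 1) = 64 * ((p + d).choose q * (p + 1)) := by ring
    _ ≤ 64 * ((p + q).choose q * (p + 1 + 2 * q * m)) := Nat.mul_le_mul_left _ h1
    _ = 64 * (p + q).choose q * (p + 1) + (p + q).choose q * (128 * q * m) := by ring
    _ ≤ 64 * (p + q).choose q * (p + 1) + (p + q).choose q * (2 ^ m * (p + 1)) :=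
        Nat.add_le_add_left (Nat.mul_le_mul_left _ h2) _
    _ = (64 + 2 ^ m) * (p + q).choose q * (p + 1) := by ring

/-- The ratio bounds of the small class: `C(p+d, q−2) ≤ 2·C(p+q, q−2)`, `C(p+d, q−3) ≤ 2·C(p+q, q−3)`,
`C(2d+2q−6+(p+d), q−4) ≤ 8·C(p+q, q−4)`, and `24·C(2d+2q−2, 4) ≤ 256·d^4`, at `q ≥ 8`, `q + 1 ≤ d ≤ q + 2^q`,
`p ≥ Tq q`. -/
theorem small_ratios2 (q d p : ℕ) (hq : 8 ≤ q) (hd1 : q + 1 ≤ d) (hd2 : d ≤ q + 2 ^ q) (hp : Tq q ≤ p) :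
    (p + d).choose (q - 2) ≤ 2 * (p + q).choose (q - 2) ∧ (p + d).choose (q - 3) ≤ 2 * (p + q).choose (q - 3) ∧
      (2 * d + 2 * q - 6 + (p + d)).choose (q - 4) ≤ 8 * (p + q).choose (q - 4) ∧
      24 * (2 * d + 2 * q - 2).choose 4 ≤ 256 * d ^ 4 := by
  obtain ⟨-, -, h2q, -⟩ := Tq_bounds q hq
  have hm : d - q ≤ 2 ^ q := by omega
  have hq2 : 2 ^ q ≥ 256 := by
    calc 2 ^ q ≥ 2 ^ 8 := Nat.pow_le_pow_right (by norm_num) hq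
      _ = 256 := by norm_num
  refine ⟨?_, ?_, ?_, ?_⟩
  · have h := choose_le_two_mul_choose (q - 2) (d - q - 1) (p + 2) (by
      have : 2 * (q - 2) * (d - q - 1 + 1) ≤ 2 * q * 2 ^ q :=
        Nat.mul_le_mul (Nat.mul_le_mul_left 2 (by omega)) (by omega)
      exact this.trans (by omega))
    rwa [show p + 2 + (q - 2) + 1 + (d - q - 1) = p + d by omega, show p + 2 + (q - 2) = p + q by omega] at h
  · have h := choose_le_two_mul_choose (q - 3) (d - q - 1) (p + 3) (by
      have : 2 * (q - 3) * (d - q - 1 + 1) ≤ 2 * q * 2 ^ q :=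
        Nat.mul_le_mul (Nat.mul_le_mul_left 2 (by omega)) (by omega)
      exact this.trans (by omega))
    rwa [show p + 3 + (q - 3) + 1 + (d - q - 1) = p + d by omega, show p + 3 + (q - 3) = p + q by omega] at h
  · have h := choose_le_eight_mul_choose (q - 4) (3 * d + q - 7) (p + 4) (by
      -- `(q−4)(3d + q − 6) ≤ 3q·2^q + 4q² ≤ 2(p+5)`
      have h1 : (q - 4) * (3 * d + q - 7 + 1) ≤ q * (3 * 2 ^ q + 4 * q) := Nat.mul_le_mul (by omega) (by omega)
      have h2 : 4 * q * q ≤ q * 2 ^ q := by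
        have : 4 * q ≤ 2 ^ q := by
          have := le_two_pow_sub_four q (by omega)
          obtain ⟨_, h16, _, _⟩ := two_pow_facts2 q hq
          omega
        nlinarith
      nlinarith)
    rwa [show p + 4 + (q - 4) + 1 + (3 * d + q - 7) = 2 * d + 2 * q - 6 + (p + d) by omega,
      show p + 4 + (q - 4) = p + q by omega] at h
  · have h := twentyfour_mul_choose_four_le (2 * d + 2 * q - 2)
    have h4 : (2 * d + 2 * q - 2) ^ 4 ≤ (4 * d) ^ 4 := Nat.pow_le_pow_left (by omega) 4
    calc 24 * (2 * d + 2 * q - 2).choose 4 ≤ (2 * d + 2 * q - 2) ^ 4 := h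
      _ ≤ (4 * d) ^ 4 := h4
      _ = 256 * d ^ 4 := by ring

/-- The levels-down with `q^k` in place of the falling factorials: `p²·C(p+q,q−2) ≤ q²·C`, `p³·C(p+q,q−3) ≤ q³·C`,
`p⁴·C(p+q,q−4) ≤ q⁴·C`. -/
theorem levels_down2 (p q : ℕ) (hq : 4 ≤ q) :
    p ^ 2 * (p + q).choose (q - 2) ≤ q ^ 2 * (p + q).choose q ∧
      p ^ 3 * (p + q).choose (q - 3) ≤ q ^ 3 * (p + q).choose q ∧
      p ^ 4 * (p + q).choose (q - 4) ≤ q ^ 4 * (p + q).choose q := by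
  refine ⟨(two_down p q (by omega)).trans (Nat.mul_le_mul_right _ ?_),
    (three_down p q (by omega)).trans (Nat.mul_le_mul_right _ ?_),
    (four_down p q hq).trans (Nat.mul_le_mul_right _ ?_)⟩
  · calc q * (q - 1) ≤ q * q := Nat.mul_le_mul_left _ (Nat.sub_le _ _)
      _ = q ^ 2 := by ring
  · calc q * (q - 1) * (q - 2) ≤ q * q * q := Nat.mul_le_mul (Nat.mul_le_mul_left _ (Nat.sub_le _ _)) (Nat.sub_le _ _)
      _ = q ^ 3 := by ring
  · calc q * (q - 1) * (q - 2) * (q - 3) ≤ q * q * q * q :=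
        Nat.mul_le_mul (Nat.mul_le_mul (Nat.mul_le_mul_left _ (Nat.sub_le _ _)) (Nat.sub_le _ _)) (Nat.sub_le _ _)
      _ = q ^ 4 := by ring

/-- The cap of regime I′ in terms of `x = 2^{q−4}`: `μ_s = min (5x − q) d`; with `d ≤ 5x` either `μ_s = d` and
`d + 1 ≤ 5x`, or `μ_s = 5x − q ≥ 4x` and `d ≤ 5x`. -/
theorem mu_s_cases (q d μ : ℕ) (hq : 8 ≤ q) (hμ : μ = min (5 * 2 ^ (q - 4) - q) d) (hd : d ≤ 5 * 2 ^ (q - 4)) :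
    (μ = d ∧ d + 1 ≤ 5 * 2 ^ (q - 4)) ∨ (4 * 2 ^ (q - 4) ≤ μ ∧ μ ≤ 5 * 2 ^ (q - 4) ∧ d ≤ 5 * 2 ^ (q - 4)) := by
  have hx := le_two_pow_sub_four q (by omega)
  rcases le_total d (5 * 2 ^ (q - 4) - q) with h | h
  · left; rw [hμ, min_eq_right h]; omega
  · right; rw [hμ, min_eq_left h]; omega

/-- **(S3), regime I′**: `24·2^q·d(d+1)·C(p+d, q−2) ≤ 7·μ_s·C(p+q, q)` for `d ≤ 5·2^{q−4}`. -/
theorem small_three_I (q d p μ : ℕ) (hq : 8 ≤ q) (hd1 : q + 1 ≤ d) (hd2 : d ≤ q + 2 ^ q) (hp : Tq q ≤ p)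
    (hμ : μ = min (5 * 2 ^ (q - 4) - q) d) (hdI : d ≤ 5 * 2 ^ (q - 4)) :
    24 * 2 ^ q * (d * (d + 1)) * (p + d).choose (q - 2) ≤ 7 * μ * (p + q).choose q := by
  obtain ⟨h2, -, -, -⟩ := small_ratios2 q d p hq hd1 hd2 hp
  obtain ⟨hdown, -, -⟩ := levels_down2 p q (by omega)
  obtain ⟨hp2, -, -, hp1⟩ := p_lin2_bounds q p hq hp
  obtain ⟨-, h16, -, -⟩ := two_pow_facts2 q hq
  set x := 2 ^ (q - 4) with hx
  have hkey : 48 * 2 ^ q * (d * (d + 1)) * q ^ 2 ≤ 7 * μ * p ^ 2 := by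
    rcases mu_s_cases q d μ hq hμ hdI with ⟨hμd, hd5⟩ | ⟨hμ4, hμ5, hd5⟩
    · -- `μ = d`: `48·16x·(d+1)·q² ≤ 48·16x·5x·q² = 3840 x² q² ≤ 7·1024 x² q²`
      rw [hμd]
      calc 48 * 2 ^ q * (d * (d + 1)) * q ^ 2 = 48 * (16 * x) * (d * (d + 1)) * q ^ 2 := by rw [h16]
        _ ≤ 48 * (16 * x) * (d * (5 * x)) * q ^ 2 := by gcongr
        _ = d * (3840 * (q ^ 2 * x ^ 2)) := by ring
        _ ≤ d * (7 * (4 * q ^ 2 * (2 ^ q) ^ 2)) := by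
            apply Nat.mul_le_mul_left
            rw [h16]; nlinarith
        _ ≤ d * (7 * p ^ 2) := Nat.mul_le_mul_left _ (Nat.mul_le_mul_left _ hp2)
        _ = 7 * d * p ^ 2 := by ring
    · -- `μ ≥ 4x`, `d ≤ 5x`: `48·16x·5x·(5x+1)·q² ≤ 48·16·30 x³ q² = 23040 x³q² ≤ 7·4x·1024 x² q² = 28672 x³q²`
      have hd6 : d + 1 ≤ 6 * x := by omega
      calc 48 * 2 ^ q * (d * (d + 1)) * q ^ 2 = 48 * (16 * x) * (d * (d + 1)) * q ^ 2 := by rw [h16]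
        _ ≤ 48 * (16 * x) * ((5 * x) * (6 * x)) * q ^ 2 := by gcongr
        _ = 23040 * (x ^ 3 * q ^ 2) := by ring
        _ ≤ 28672 * (x ^ 3 * q ^ 2) := Nat.mul_le_mul_right _ (by norm_num)
        _ = 7 * (4 * x) * (4 * q ^ 2 * (16 * x) ^ 2) := by ring
        _ ≤ 7 * μ * (4 * q ^ 2 * (2 ^ q) ^ 2) := by rw [h16]; gcongr
        _ ≤ 7 * μ * p ^ 2 := Nat.mul_le_mul_left _ hp2
  have hpos : 0 < p ^ 2 := by positivity
  apply Nat.le_of_mul_le_mul_right _ hpos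
  calc 24 * 2 ^ q * (d * (d + 1)) * (p + d).choose (q - 2) * p ^ 2
      ≤ 24 * 2 ^ q * (d * (d + 1)) * (2 * (p + q).choose (q - 2)) * p ^ 2 := by gcongr
    _ = 48 * 2 ^ q * (d * (d + 1)) * (p ^ 2 * (p + q).choose (q - 2)) := by ring
    _ ≤ 48 * 2 ^ q * (d * (d + 1)) * (q ^ 2 * (p + q).choose q) := Nat.mul_le_mul_left _ hdown
    _ = (48 * 2 ^ q * (d * (d + 1)) * q ^ 2) * (p + q).choose q := by ring
    _ ≤ (7 * μ * p ^ 2) * (p + q).choose q := Nat.mul_le_mul_right _ hkey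
    _ = 7 * μ * (p + q).choose q * p ^ 2 := by ring

/-- **(S4), regime I′**: `32·2^q·d(d+1)(d+2)·C(p+d, q−3) ≤ 3·μ_s·C(p+q, q)` for `d ≤ 5·2^{q−4}`. -/
theorem small_four_I (q d p μ : ℕ) (hq : 8 ≤ q) (hd1 : q + 1 ≤ d) (hd2 : d ≤ q + 2 ^ q) (hp : Tq q ≤ p)
    (hμ : μ = min (5 * 2 ^ (q - 4) - q) d) (hdI : d ≤ 5 * 2 ^ (q - 4)) :
    32 * 2 ^ q * (d * (d + 1) * (d + 2)) * (p + d).choose (q - 3) ≤ 3 * μ * (p + q).choose q := by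
  obtain ⟨-, h3, -, -⟩ := small_ratios2 q d p hq hd1 hd2 hp
  obtain ⟨-, hdown, -⟩ := levels_down2 p q (by omega)
  obtain ⟨-, hp3, -, hp1⟩ := p_lin2_bounds q p hq hp
  obtain ⟨-, h16, -, -⟩ := two_pow_facts2 q hq
  set x := 2 ^ (q - 4) with hx
  have hx1 : 1 ≤ x := Nat.one_le_two_pow
  have hkey : 64 * 2 ^ q * (d * (d + 1) * (d + 2)) * q ^ 3 ≤ 3 * μ * p ^ 3 := by
    rcases mu_s_cases q d μ hq hμ hdI with ⟨hμd, hd5⟩ | ⟨hμ4, hμ5, hd5⟩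
    · -- `μ = d`: `64·16x·(d+1)(d+2)·q³ ≤ 64·16x·5x·6x·q³ = 30720 x³q³ ≤ 3·8·4096 x³ q³`
      rw [hμd]
      have hd6 : d + 2 ≤ 6 * x := by omega
      calc 64 * 2 ^ q * (d * (d + 1) * (d + 2)) * q ^ 3 = 64 * (16 * x) * (d * ((d + 1) * (d + 2))) * q ^ 3 := by
            rw [h16]; ring
        _ ≤ 64 * (16 * x) * (d * ((5 * x) * (6 * x))) * q ^ 3 := by gcongr
        _ = d * (30720 * (q ^ 3 * x ^ 3)) := by ring
        _ ≤ d * (3 * (8 * q ^ 3 * (16 * x) ^ 3)) := Nat.mul_le_mul_left _ (by ring_nf; omega)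
        _ = 3 * d * (8 * q ^ 3 * (2 ^ q) ^ 3) := by rw [h16]; ring
        _ ≤ 3 * d * p ^ 3 := Nat.mul_le_mul_left _ hp3
    · have hd6 : d + 1 ≤ 6 * x := by omega
      have hd7 : d + 2 ≤ 7 * x := by omega
      calc 64 * 2 ^ q * (d * (d + 1) * (d + 2)) * q ^ 3 = 64 * (16 * x) * (d * (d + 1) * (d + 2)) * q ^ 3 := by
            rw [h16]
        _ ≤ 64 * (16 * x) * ((5 * x) * (6 * x) * (7 * x)) * q ^ 3 := by gcongr
        _ = 215040 * (x ^ 4 * q ^ 3) := by ring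
        _ ≤ 393216 * (x ^ 4 * q ^ 3) := Nat.mul_le_mul_right _ (by norm_num)
        _ = 3 * (4 * x) * (8 * q ^ 3 * (16 * x) ^ 3) := by ring
        _ ≤ 3 * μ * (8 * q ^ 3 * (2 ^ q) ^ 3) := by rw [h16]; gcongr
        _ ≤ 3 * μ * p ^ 3 := Nat.mul_le_mul_left _ hp3
  have hpos : 0 < p ^ 3 := by positivity
  apply Nat.le_of_mul_le_mul_right _ hpos
  calc 32 * 2 ^ q * (d * (d + 1) * (d + 2)) * (p + d).choose (q - 3) * p ^ 3
      ≤ 32 * 2 ^ q * (d * (d + 1) * (d + 2)) * (2 * (p + q).choose (q - 3)) * p ^ 3 := by gcongr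
    _ = 64 * 2 ^ q * (d * (d + 1) * (d + 2)) * (p ^ 3 * (p + q).choose (q - 3)) := by ring
    _ ≤ 64 * 2 ^ q * (d * (d + 1) * (d + 2)) * (q ^ 3 * (p + q).choose q) := Nat.mul_le_mul_left _ hdown
    _ = (64 * 2 ^ q * (d * (d + 1) * (d + 2)) * q ^ 3) * (p + q).choose q := by ring
    _ ≤ (3 * μ * p ^ 3) * (p + q).choose q := Nat.mul_le_mul_right _ hkey
    _ = 3 * μ * (p + q).choose q * p ^ 3 := by ring

/-- **(S5), regime I′**: `96·2^q·C(2d+2q−2, 4)·C(2d+2q−6+(p+d), q−4) ≤ 35·μ_s·C(p+q, q)` for `d ≤ 5·2^{q−4}`. -/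
theorem small_five_I (q d p μ : ℕ) (hq : 8 ≤ q) (hd1 : q + 1 ≤ d) (hd2 : d ≤ q + 2 ^ q) (hp : Tq q ≤ p)
    (hμ : μ = min (5 * 2 ^ (q - 4) - q) d) (hdI : d ≤ 5 * 2 ^ (q - 4)) :
    96 * 2 ^ q * (2 * d + 2 * q - 2).choose 4 * (2 * d + 2 * q - 6 + (p + d)).choose (q - 4) ≤
      35 * μ * (p + q).choose q := by
  obtain ⟨-, -, h8, h4⟩ := small_ratios2 q d p hq hd1 hd2 hp
  obtain ⟨-, -, hdown⟩ := levels_down2 p q (by omega)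
  obtain ⟨-, -, hp4, hp1⟩ := p_lin2_bounds q p hq hp
  obtain ⟨-, h16, -, -⟩ := two_pow_facts2 q hq
  set x := 2 ^ (q - 4) with hx
  have hx1 : 1 ≤ x := Nat.one_le_two_pow
  -- the key: `196608·2^q·d⁴·q⁴ ≤ 840·μ·p⁴`
  have hkey : 196608 * 2 ^ q * d ^ 4 * q ^ 4 ≤ 840 * μ * p ^ 4 := by
    rcases mu_s_cases q d μ hq hμ hdI with ⟨hμd, hd5⟩ | ⟨hμ4, hμ5, hd5⟩
    · -- `μ = d`: `196608·16x·d³·q⁴ ≤ 196608·16·125 x⁴ q⁴ = 393216000 x⁴q⁴ ≤ 840·16·65536 x⁴q⁴`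
      rw [hμd]
      have hd5' : d ≤ 5 * x := by omega
      calc 196608 * 2 ^ q * d ^ 4 * q ^ 4 = d * (196608 * (16 * x) * d ^ 3 * q ^ 4) := by rw [h16]; ring
        _ ≤ d * (196608 * (16 * x) * (5 * x) ^ 3 * q ^ 4) := by gcongr
        _ = d * (393216000 * (x ^ 4 * q ^ 4)) := by ring
        _ ≤ d * (880803840 * (x ^ 4 * q ^ 4)) := Nat.mul_le_mul_left _ (Nat.mul_le_mul_right _ (by norm_num))
        _ = 840 * d * (16 * q ^ 4 * (16 * x) ^ 4) := by ring
        _ ≤ 840 * d * p ^ 4 := by rw [← h16]; exact Nat.mul_le_mul_left _ hp4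
    · calc 196608 * 2 ^ q * d ^ 4 * q ^ 4 = 196608 * (16 * x) * d ^ 4 * q ^ 4 := by rw [h16]
        _ ≤ 196608 * (16 * x) * (5 * x) ^ 4 * q ^ 4 := by gcongr
        _ = 1966080000 * (x ^ 5 * q ^ 4) := by ring
        _ ≤ 3523215360 * (x ^ 5 * q ^ 4) := Nat.mul_le_mul_right _ (by norm_num)
        _ = 840 * (4 * x) * (16 * q ^ 4 * (16 * x) ^ 4) := by ring
        _ ≤ 840 * μ * (16 * q ^ 4 * (2 ^ q) ^ 4) := by rw [h16]; gcongr
        _ ≤ 840 * μ * p ^ 4 := Nat.mul_le_mul_left _ hp4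
  have hpos : 0 < 24 * p ^ 4 := by positivity
  apply Nat.le_of_mul_le_mul_right _ hpos
  calc 96 * 2 ^ q * (2 * d + 2 * q - 2).choose 4 * (2 * d + 2 * q - 6 + (p + d)).choose (q - 4) * (24 * p ^ 4)
      = 96 * 2 ^ q * (24 * (2 * d + 2 * q - 2).choose 4) * (2 * d + 2 * q - 6 + (p + d)).choose (q - 4) * p ^ 4 := by
        ring
    _ ≤ 96 * 2 ^ q * (256 * d ^ 4) * (8 * (p + q).choose (q - 4)) * p ^ 4 := by gcongr
    _ = 196608 * 2 ^ q * d ^ 4 * (p ^ 4 * (p + q).choose (q - 4)) := by ring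
    _ ≤ 196608 * 2 ^ q * d ^ 4 * (q ^ 4 * (p + q).choose q) := Nat.mul_le_mul_left _ hdown
    _ = (196608 * 2 ^ q * d ^ 4 * q ^ 4) * (p + q).choose q := by ring
    _ ≤ (840 * μ * p ^ 4) * (p + q).choose q := Nat.mul_le_mul_right _ hkey
    _ = 35 * μ * (p + q).choose q * (24 * p ^ 4) := by ring

/-- `(q + 1)^2 ≤ 2^q` for `q ≥ 6`. -/
theorem sq_succ_le_two_pow (q : ℕ) (hq : 6 ≤ q) : (q + 1) ^ 2 ≤ 2 ^ q := by
  induction q, hq using Nat.le_induction with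
  | base => norm_num
  | succ q hq ih =>
    calc (q + 1 + 1) ^ 2 ≤ 2 * (q + 1) ^ 2 := by nlinarith
      _ ≤ 2 * 2 ^ q := by omega
      _ = 2 ^ (q + 1) := by ring

/-- **The small class at `d = q + 1`** (budget `6`): `4·2^q·A6 ≤ 6·μ_s·C(p+q, q)` with `μ_s = q + 1`. -/
theorem small_I_succ (q p μ : ℕ) (hq : 8 ≤ q) (hp : Tq q ≤ p)
    (hμ : μ = min (5 * 2 ^ (q - 4) - q) (q + 1)) :
    4 * 2 ^ q * (3 * ((q + 1) * (q + 1 + 1)) * (p + (q + 1)).choose (q - 2) +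
      2 * ((q + 1) * (q + 1 + 1) * (q + 1 + 2)) * (p + (q + 1)).choose (q - 3) +
      6 * ((2 * (q + 1) + 2 * q - 2).choose 4 * (2 * (q + 1) + 2 * q - 6 + (p + (q + 1))).choose (q - 4))) ≤
      6 * μ * (p + q).choose q := by
  have hq2 : 2 ^ q ≥ 256 := by
    calc 2 ^ q ≥ 2 ^ 8 := Nat.pow_le_pow_right (by norm_num) hq
      _ = 256 := by norm_num
  have hx := le_two_pow_sub_four q (by omega)
  obtain ⟨-, h16, -, -⟩ := two_pow_facts2 q hq
  have hμ' : μ = q + 1 := by rw [hμ, min_eq_right (by omega)]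
  subst hμ'
  have hd2 : q + 1 ≤ q + 2 ^ q := by omega
  obtain ⟨h2, h3, h8, h4⟩ := small_ratios2 q (q + 1) p hq le_rfl hd2 hp
  obtain ⟨hd2', hd3', hd4'⟩ := levels_down2 p q (by omega)
  obtain ⟨hp2, hp3, hp4, hp1⟩ := p_lin2_bounds q p hq hp
  set C := (p + q).choose q with hC
  -- the three terms, each `≤ 2·(q+1)·C`
  have hq8 : 8 ≤ q := hq
  have t1 : 4 * 2 ^ q * (3 * ((q + 1) * (q + 1 + 1)) * (p + (q + 1)).choose (q - 2)) ≤ 2 * (q + 1) * C := by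
    have hpos : 0 < p ^ 2 := by positivity
    apply Nat.le_of_mul_le_mul_right _ hpos
    have hkey : 24 * 2 ^ q * (q + 2) * q ^ 2 ≤ 2 * p ^ 2 := by
      have h1 : 3 * (q + 2) ≤ 2 ^ q := by omega
      calc 24 * 2 ^ q * (q + 2) * q ^ 2 = 8 * (3 * (q + 2)) * 2 ^ q * q ^ 2 := by ring
        _ ≤ 8 * 2 ^ q * 2 ^ q * q ^ 2 := by gcongr
        _ = 2 * (4 * q ^ 2 * (2 ^ q) ^ 2) := by ring
        _ ≤ 2 * p ^ 2 := Nat.mul_le_mul_left _ hp2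
    calc 4 * 2 ^ q * (3 * ((q + 1) * (q + 1 + 1)) * (p + (q + 1)).choose (q - 2)) * p ^ 2
        ≤ 4 * 2 ^ q * (3 * ((q + 1) * (q + 1 + 1)) * (2 * (p + q).choose (q - 2))) * p ^ 2 := by gcongr
      _ = (q + 1) * (24 * 2 ^ q * (q + 2)) * (p ^ 2 * (p + q).choose (q - 2)) := by ring
      _ ≤ (q + 1) * (24 * 2 ^ q * (q + 2)) * (q ^ 2 * C) := Nat.mul_le_mul_left _ hd2'
      _ = (q + 1) * (24 * 2 ^ q * (q + 2) * q ^ 2) * C := by ring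
      _ ≤ (q + 1) * (2 * p ^ 2) * C := by gcongr
      _ = 2 * (q + 1) * C * p ^ 2 := by ring
  have t2 : 4 * 2 ^ q * (2 * ((q + 1) * (q + 1 + 1) * (q + 1 + 2)) * (p + (q + 1)).choose (q - 3)) ≤
      2 * (q + 1) * C := by
    have hpos : 0 < p ^ 3 := by positivity
    apply Nat.le_of_mul_le_mul_right _ hpos
    have hkey : 16 * 2 ^ q * ((q + 2) * (q + 3)) * q ^ 3 ≤ 2 * p ^ 3 := by
      have h1 : (q + 2) * (q + 3) ≤ 2 ^ q * 2 ^ q := Nat.mul_le_mul (by omega) (by omega)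
      calc 16 * 2 ^ q * ((q + 2) * (q + 3)) * q ^ 3 ≤ 16 * 2 ^ q * (2 ^ q * 2 ^ q) * q ^ 3 := by gcongr
        _ = 2 * (8 * q ^ 3 * (2 ^ q) ^ 3) := by ring
        _ ≤ 2 * p ^ 3 := Nat.mul_le_mul_left _ hp3
    calc 4 * 2 ^ q * (2 * ((q + 1) * (q + 1 + 1) * (q + 1 + 2)) * (p + (q + 1)).choose (q - 3)) * p ^ 3
        ≤ 4 * 2 ^ q * (2 * ((q + 1) * (q + 1 + 1) * (q + 1 + 2)) * (2 * (p + q).choose (q - 3))) * p ^ 3 := by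
          gcongr
      _ = (q + 1) * (16 * 2 ^ q * ((q + 2) * (q + 3))) * (p ^ 3 * (p + q).choose (q - 3)) := by ring
      _ ≤ (q + 1) * (16 * 2 ^ q * ((q + 2) * (q + 3))) * (q ^ 3 * C) := Nat.mul_le_mul_left _ hd3'
      _ = (q + 1) * (16 * 2 ^ q * ((q + 2) * (q + 3)) * q ^ 3) * C := by ring
      _ ≤ (q + 1) * (2 * p ^ 3) * C := by gcongr
      _ = 2 * (q + 1) * C * p ^ 3 := by ring
  have t3 : 4 * 2 ^ q * (6 * ((2 * (q + 1) + 2 * q - 2).choose 4 *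
      (2 * (q + 1) + 2 * q - 6 + (p + (q + 1))).choose (q - 4))) ≤ 2 * (q + 1) * C := by
    have hpos : 0 < 24 * p ^ 4 := by positivity
    apply Nat.le_of_mul_le_mul_right _ hpos
    -- `24·C(4q, 4) ≤ 256·(q+1)⁴`, the ratio `8`, `p⁴·C(p+q, q−4) ≤ q⁴·C`; key: `196608·2^q·(q+1)³·q⁴ ≤ 48·p⁴`
    have hkey : 49152 * 2 ^ q * (q + 1) ^ 3 * q ^ 4 ≤ 48 * p ^ 4 := by
      have h1 : (q + 1) ^ 3 ≤ 2 ^ q * 2 ^ q := by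
        have h1a : q + 1 ≤ 2 ^ q := succ_le_two_pow q
        have h1b : (q + 1) ^ 2 ≤ 2 ^ q := sq_succ_le_two_pow q (by omega)
        calc (q + 1) ^ 3 = (q + 1) ^ 2 * (q + 1) := by ring
          _ ≤ 2 ^ q * 2 ^ q := Nat.mul_le_mul h1b h1a
      have h2 : 49152 ≤ 48 * 16 * 2 ^ q := by omega
      calc 49152 * 2 ^ q * (q + 1) ^ 3 * q ^ 4 ≤ (48 * 16 * 2 ^ q) * 2 ^ q * (2 ^ q * 2 ^ q) * q ^ 4 := by
            gcongr
        _ = 48 * (16 * q ^ 4 * (2 ^ q) ^ 4) := by ring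
        _ ≤ 48 * p ^ 4 := Nat.mul_le_mul_left _ hp4
    calc 4 * 2 ^ q * (6 * ((2 * (q + 1) + 2 * q - 2).choose 4 *
          (2 * (q + 1) + 2 * q - 6 + (p + (q + 1))).choose (q - 4))) * (24 * p ^ 4)
        = 4 * 2 ^ q * 6 * (24 * (2 * (q + 1) + 2 * q - 2).choose 4) *
            (2 * (q + 1) + 2 * q - 6 + (p + (q + 1))).choose (q - 4) * p ^ 4 := by ring
      _ ≤ 4 * 2 ^ q * 6 * (256 * (q + 1) ^ 4) * (8 * (p + q).choose (q - 4)) * p ^ 4 := by gcongr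
      _ = (q + 1) * (49152 * 2 ^ q * (q + 1) ^ 3) * (p ^ 4 * (p + q).choose (q - 4)) := by ring
      _ ≤ (q + 1) * (49152 * 2 ^ q * (q + 1) ^ 3) * (q ^ 4 * C) := Nat.mul_le_mul_left _ hd4'
      _ = (q + 1) * (49152 * 2 ^ q * (q + 1) ^ 3 * q ^ 4) * C := by ring
      _ ≤ (q + 1) * (48 * p ^ 4) * C := by gcongr
      _ = 2 * (q + 1) * C * (24 * p ^ 4) := by ring
  calc 4 * 2 ^ q * (3 * ((q + 1) * (q + 1 + 1)) * (p + (q + 1)).choose (q - 2) +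
        2 * ((q + 1) * (q + 1 + 1) * (q + 1 + 2)) * (p + (q + 1)).choose (q - 3) +
        6 * ((2 * (q + 1) + 2 * q - 2).choose 4 * (2 * (q + 1) + 2 * q - 6 + (p + (q + 1))).choose (q - 4)))
      = 4 * 2 ^ q * (3 * ((q + 1) * (q + 1 + 1)) * (p + (q + 1)).choose (q - 2)) +
        4 * 2 ^ q * (2 * ((q + 1) * (q + 1 + 1) * (q + 1 + 2)) * (p + (q + 1)).choose (q - 3)) +
        4 * 2 ^ q * (6 * ((2 * (q + 1) + 2 * q - 2).choose 4 *
          (2 * (q + 1) + 2 * q - 6 + (p + (q + 1))).choose (q - 4))) := by ring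
    _ ≤ 2 * (q + 1) * C + 2 * (q + 1) * C + 2 * (q + 1) * C := by gcongr
    _ = 6 * (q + 1) * C := by ring

end Explicit

end ThmN

end PercRepro
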